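import Summits.ValiantsHypothesis.ValiantsHypothesis.Theorems.KPlusLogSqLawTropicalBThresholdIff
import Summits.ValiantsHypothesis.ValiantsHypothesis.Theorems.KPlusLogSqLawTropicalBKDoubling

/-!
# Route «KPlusLogSqLaw», crux `TropicalB` (stmt-ValiantsHypothesis-19771) — calibration: NO POLYNOMIAL vertex law survives at
# `3(⌊log₂ m⌋ + 1)` boundaries (the log-boundary sector is super-polynomial, by the staircase)

HONEST FRAMING.  Helper toward the registered stubs `stub_tropThin` / `stub_tropFat` of `Cruxes/TropicalB/Lines/birth.lean`
(crux `Summit.ValiantsHypothesis.ValiantsHypothesis.Theses.KPlusLogSqLaw.TropicalB`, item `stmt-ValiantsHypothesis-19771`, route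
`KPlusLogSqLaw`; cell `pub-symmetroid`, seat val-sym-trop-p1 g15, 2026-08-28; `--supports … --as helper`).  A CALIBRATION of the boundary-type
sector (p447010) complementing the normal form `tropicalB_iff_logBoundaries` (p600867): nothing here is in-window, nothing bears on `TropicalB`,
`WeakLifting`, DoorA26 / DoorA34, `MatrixDescartes` (stmt-ValiantsHypothesis-18050) or VP ≠ VNP.  No definition is introduced.

* `tropRootLawAt_of_polyLogBoundaries` — a polynomial vertex law `#Dom ≤ C·(m+1)^c` for dense boundary-type designs with
  `B ≤ 3(⌊log₂ m⌋+1)` boundaries would give the census rows `TropRootLawAt m K (C·(2^(⌊log₂(mK)⌋+1) + 1)^c − 1)` (threshold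
  embedding, size padding, static ports);
* `not_polyLogBoundaries` — **hence no such law exists, for any `(C, c)`**: at `K = 2c + 2` classes the rows would read
  `T(m, 2c+2) ≤ 2^A·m^c` for all `m`, which the tree's kernel staircase refutes (`KDoubling.staircase_beats_pow`, from
  `WalkDesign.staircase_lower`: format `(m, L+1)` designs with `≥ n^L − 1` breakpoints on `m ≤ 2^(2L+2)·n²` nodes).
READING.  The boundary programme has three regimes, all now in the kernel: FIXED `B` (polynomial by counting, exponent `2^B − 1`,
conjecturally much less — `BoundaryVertexLaw 2 2` open); LINEAR labelling of `r` biorders (degree `r`, `…TropicalBFerrersRank`); and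
`B = 3(⌊log₂ m⌋+1)` with arbitrary labelling, which is the whole crux (`tropicalB_iff_logBoundaries`) and provably NOT polynomial (this file).
[this cell]
-/

set_option linter.dupNamespace false
set_option autoImplicit false

namespace Summit.ValiantsHypothesis.ValiantsHypothesis.Theorems.KPlusLogSqLaw

namespace BoundarySector

open Summit.ValiantsHypothesis.ValiantsHypothesis.Theorems.MatrixDescartes.Negative
open Summit.ValiantsHypothesis.ValiantsHypothesis.Theorems.LacunarySymmetroidMatrixDescartes
open Summit.ValiantsHypothesis.ValiantsHypothesis.Theorems.LacunarySymmetroidMatrixDescartes.TropicalCensus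
open scoped BigOperators
open Finset

open scoped Classical in
/-- the static vertex count at size `2^L` from a polynomial log-boundary law. [this cell] -/
theorem card_dominant_static_le_of_polyLogBoundaries {C c : ℕ}
    (hC : ∀ (B n K' : ℕ) (π ρ : Fin B → Equiv.Perm (Fin n)) (lab : (Fin B → Bool) → Fin K') (d : Fin K' → ℕ)
      (v ε : Fin n → Fin n → Fin K' → ℤ), IsBoundaryDesign π ρ lab ε → B ≤ 3 * (Nat.log 2 n + 1) →
      (univ.filter fun q : Equiv.Perm (Fin n) × (Fin n → Fin K') => ∃ t : ℤ, IsDominant d v ε t q).card ≤ C * (n + 1) ^ c)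
    (L K : ℕ) (d : Fin K → ℕ) (v ε : Fin (2 ^ L) → Fin (2 ^ L) → Fin K → ℤ) (hstat : IsStatic ε) :
    (univ.filter fun q : Equiv.Perm (Fin (2 ^ L)) × (Fin (2 ^ L) → Fin K) => ∃ t : ℤ, IsDominant d v ε t q).card ≤
      C * (2 ^ L + 1) ^ c := by
  obtain ⟨π, ρ, hcode⟩ := exists_injective_code L
  obtain ⟨lab, d', v', ε', hbd, -, hle⟩ := card_dominant_le_of_code π ρ hcode d v ε hstat
  have hlog : Nat.log 2 (2 ^ L) = L := Nat.log_pow one_lt_two L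
  have hB : 3 * L ≤ 3 * (Nat.log 2 (2 ^ L) + 1) := by rw [hlog]; omega
  exact hle.trans (hC _ _ _ π ρ lab d' v' ε' hbd hB)

open scoped Classical in
/-- the static census row at size `2^L` from a polynomial log-boundary law. [this cell] -/
theorem tropRootLawAtStatic_pow_of_polyLogBoundaries {C c : ℕ}
    (hC : ∀ (B n K' : ℕ) (π ρ : Fin B → Equiv.Perm (Fin n)) (lab : (Fin B → Bool) → Fin K') (d : Fin K' → ℕ)
      (v ε : Fin n → Fin n → Fin K' → ℤ), IsBoundaryDesign π ρ lab ε → B ≤ 3 * (Nat.log 2 n + 1) →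
      (univ.filter fun q : Equiv.Perm (Fin n) × (Fin n → Fin K') => ∃ t : ℤ, IsDominant d v ε t q).card ≤ C * (n + 1) ^ c)
    (L K : ℕ) : TropRootLawAtStatic (2 ^ L) K (C * (2 ^ L + 1) ^ c - 1) := by
  classical
  intro d v ε n θ p _ hstat hθ hdom halt
  have h1 := succ_le_card_dominant d v ε θ p hθ hdom (ne_succ_of_alternating ε p halt)
  have h2 := card_dominant_static_le_of_polyLogBoundaries hC L K d v ε hstat
  omega

open scoped Classical in
/-- **the general census row from a polynomial log-boundary law** (size padding to `2^(⌊log₂(mK)⌋+1)`, static ports at size `mK`).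
[this cell] -/
theorem tropRootLawAt_of_polyLogBoundaries {C c : ℕ}
    (hC : ∀ (B n K' : ℕ) (π ρ : Fin B → Equiv.Perm (Fin n)) (lab : (Fin B → Bool) → Fin K') (d : Fin K' → ℕ)
      (v ε : Fin n → Fin n → Fin K' → ℤ), IsBoundaryDesign π ρ lab ε → B ≤ 3 * (Nat.log 2 n + 1) →
      (univ.filter fun q : Equiv.Perm (Fin n) × (Fin n → Fin K') => ∃ t : ℤ, IsDominant d v ε t q).card ≤ C * (n + 1) ^ c)
    (m K : ℕ) : TropRootLawAt m K (C * (2 ^ (Nat.log 2 (m * K) + 1) + 1) ^ c - 1) :=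
  tropRootLawAt_of_static_ports_le le_rfl
    (tropRootLawAtStatic_of_le_size (Nat.lt_pow_succ_log_self one_lt_two (m * K)).le
      (tropRootLawAtStatic_pow_of_polyLogBoundaries hC _ K))

/-- arithmetic: `C·(2^(⌊log₂(mK)⌋+1) + 1)^c − 1 ≤ 2^(C + 2c + K·c)·m^c` for `m ≥ 1`. [folklore] -/
theorem polyBudget_le (C c m K : ℕ) (hm : 1 ≤ m) :
    C * (2 ^ (Nat.log 2 (m * K) + 1) + 1) ^ c - 1 ≤ 2 ^ (C + 2 * c + K * c) * m ^ c := by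
  have h1 : 2 ^ (Nat.log 2 (m * K) + 1) + 1 ≤ 4 * m * 2 ^ K := by
    have hK : K ≤ 2 ^ K := Nat.lt_two_pow_self.le
    rcases Nat.eq_zero_or_pos K with rfl | hKpos
    · simp; omega
    · have h2 : 2 ^ Nat.log 2 (m * K) ≤ m * K := Nat.pow_log_le_self 2 (Nat.pos_iff_ne_zero.1 (Nat.mul_pos hm hKpos))
      have h3 : 1 ≤ m * K := Nat.mul_pos hm hKpos
      calc 2 ^ (Nat.log 2 (m * K) + 1) + 1 = 2 * 2 ^ Nat.log 2 (m * K) + 1 := by rw [pow_succ]; ring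
        _ ≤ 2 * (m * K) + m * K := by omega
        _ ≤ 4 * m * K := by nlinarith
        _ ≤ 4 * m * 2 ^ K := Nat.mul_le_mul_left _ hK
  have h2 : (2 ^ (Nat.log 2 (m * K) + 1) + 1) ^ c ≤ (4 * m * 2 ^ K) ^ c := Nat.pow_le_pow_left h1 c
  have h3 : (4 * m * 2 ^ K) ^ c = 2 ^ (2 * c + K * c) * m ^ c := by
    rw [show (4 : ℕ) * m * 2 ^ K = (2 ^ 2 * 2 ^ K) * m by ring, mul_pow, ← pow_add, ← pow_mul]
    ring_nf
  have hC : C ≤ 2 ^ C := Nat.lt_two_pow_self.le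
  calc C * (2 ^ (Nat.log 2 (m * K) + 1) + 1) ^ c - 1 ≤ C * (2 ^ (Nat.log 2 (m * K) + 1) + 1) ^ c := Nat.sub_le _ _
    _ ≤ 2 ^ C * (2 ^ (2 * c + K * c) * m ^ c) := Nat.mul_le_mul hC (h2.trans h3.le)
    _ = 2 ^ (C + 2 * c + K * c) * m ^ c := by rw [← mul_assoc, ← pow_add]; ring_nf

open scoped Classical in
/-- **NO POLYNOMIAL VERTEX LAW AT `3(⌊log₂ m⌋+1)` BOUNDARIES.**  For no constants `(C, c)` does every dense boundary-type design with
`B ≤ 3(⌊log₂ m⌋ + 1)` boundaries have at most `C·(m+1)^c` dominant terms: such a law would make the census row `T(m, 2c+2)` at most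
`2^A·m^c` for all `m`, against the kernel staircase (`KDoubling.staircase_beats_pow`). [this cell] -/
theorem not_polyLogBoundaries (C c : ℕ) :
    ¬ ∀ (B n K' : ℕ) (π ρ : Fin B → Equiv.Perm (Fin n)) (lab : (Fin B → Bool) → Fin K') (d : Fin K' → ℕ)
      (v ε : Fin n → Fin n → Fin K' → ℤ), IsBoundaryDesign π ρ lab ε → B ≤ 3 * (Nat.log 2 n + 1) →
      (Finset.univ.filter fun q : Equiv.Perm (Fin n) × (Fin n → Fin K') => ∃ t : ℤ, IsDominant d v ε t q).card ≤ C * (n + 1) ^ c := by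
  intro hC
  set L := 2 * c + 1 with hL
  refine KDoubling.staircase_beats_pow (C + 2 * c + (L + 1) * c) c L (by omega) (by omega) fun m hm => ?_
  exact tropRootLawAt_mono (polyBudget_le C c m (L + 1) hm) (tropRootLawAt_of_polyLogBoundaries hC m (L + 1))

end BoundarySector

end Summit.ValiantsHypothesis.ValiantsHypothesis.Theorems.KPlusLogSqLaw
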